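import Literature.AlgebraicGeometry.Resolution.AffineBlowupRegular
import Mathlib.AlgebraicGeometry.AffineScheme
import HarnessLib

/-!
# Stalks of the affine blowing up are local rings of the charts at the generators

Support file for crux stmt-ResolutionOfSingularities-15315
(`FrobeniusLadder.FInjectiveMacaulayfication`, line `Sketch`, lead seat c4, cycle 5, wave 1):
stub `stub_stalkChartIso` of the §6 BLOW-UP GLUE (E6) package.

For a commutative ring `R` and generators `x = (x₁, …, x_r)` of the ideal `I = (x₁, …, x_r)`, the
blowing up `Bl_I(Spec R) = affineBlowup I = Proj R[It]` is covered by the charts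
`D₊(xᵢt) = Spec (R[It])_{(xᵢt)}` at the generators
(`affineBlowup.iSup_basicOpen_reesT_generators_eq_top`; Stacks Project, Tag 0804: the affine blowup
algebras cover the blowing up). We prove the resulting dictionary between stalks of the blowing
up and local rings of the chart rings:

* `reesT_eq_zero` — `a t = 0` in `R[It]` when `a = 0`; hence the chart `D₊(0 · t) = D₊(0) = ∅`
  of a vanishing generator is empty, so every point lies in the chart of a NON-ZERO generator
  (`exists_mem_basicOpen_reesT`);
* `stub_stalkChartIso` — the registered stub: every point `y` of `affineBlowup I` lies in the
  chart `D₊(xᵢt)` of some generator `xᵢ ≠ 0`, and its stalk `𝒪_{Bl, y}` is ring-isomorphic to the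
  localization `A_q` of the chart ring `A = (R[It])_{(xᵢt)} = HomogeneousLocalization.Away …` at
  the prime `q` corresponding to `y` under the open immersion
  `Proj.awayι : Spec A ⟶ Proj R[It]` (whose range is `D₊(xᵢt)`, `Proj.opensRange_awayι`): the
  stalk map of an open immersion is an isomorphism, and the stalk of `Spec A` at `q` is `A_q`
  (`Spec.stalkIso`).

References: The Stacks Project, Tag 0804 (Lemma 31.32.2: the affine blowup algebras `R[I/a]`
cover the blowing up); R. Hartshorne, *Algebraic Geometry*, Prop. II.2.5 (charts of `Proj`) and
Prop. II.2.2 (stalks of `Spec`); the rest is folklore.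
-/

-- single-problem summit: the doubled namespace component is forced
set_option linter.dupNamespace false

namespace Summit.ResolutionOfSingularities.ResolutionOfSingularities.Theorems.FInjectiveMacaulayfication.StalkChartIso

open AlgebraicGeometry CategoryTheory Literature.AlgebraicGeometry.Resolution

/-- `a t = 0` in the Rees algebra `R[It]` when `a = 0`. [folklore] -/
theorem reesT_eq_zero {R : Type*} [CommRing R] {I : Ideal R} (a : R) (ha : a ∈ I) (h0 : a = 0) :
    reesT a ha = 0 := by
  apply Subtype.ext
  rw [coe_reesT, h0, map_zero]
  rfl

/-- Every point of `Bl_I(Spec R)`, `I = (x₁, …, x_r)`, lies in the chart `D₊(xᵢt)` of some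
non-zero generator `xᵢ`: the charts at the generators cover, and `D₊(0) = ∅`.
[cite: StacksProject, Tag 0804] -/
theorem exists_mem_basicOpen_reesT {R : Type*} [CommRing R] {r : ℕ} (x : Fin r → R)
    (y : ↥(affineBlowup (Ideal.span (Set.range x)))) :
    ∃ i : Fin r, x i ≠ 0 ∧ y ∈ Proj.basicOpen (reesGrading (Ideal.span (Set.range x)))
      (reesT (x i) (Ideal.subset_span (Set.mem_range_self i))) := by
  have hy : y ∈ (⨆ i : Fin r, Proj.basicOpen (reesGrading (Ideal.span (Set.range x)))
      (reesT (x i) (Ideal.mem_span_range_self (f := x) (x := i)))) := by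
    rw [affineBlowup.iSup_basicOpen_reesT_generators_eq_top x]; trivial
  obtain ⟨i, hi⟩ := TopologicalSpace.Opens.mem_iSup.mp hy
  refine ⟨i, fun h0 => ?_, hi⟩
  rw [reesT_eq_zero (x i) _ h0, Proj.basicOpen_zero] at hi
  exact hi

/-- **Stalks of the blowing up are local rings of the charts** (registered stub
`stub_stalkChartIso`): every point `y` of `Bl_I(Spec R) = affineBlowup I`, `I = (x₁, …, x_r)`,
lies in the chart `D₊(xᵢt)` of some non-zero generator `xᵢ`, and its stalk is ring-isomorphic to
the localization of the chart ring `(R[It])_{(xᵢt)}` at the corresponding prime `q`: the open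
immersion `Proj.awayι : Spec (R[It])_{(xᵢt)} ⟶ Proj R[It]` has range `D₊(xᵢt)`, its stalk maps
are isomorphisms, and the stalk of `Spec A` at `q` is `A_q`. [cite: StacksProject, Tag 0804] -/
theorem stub_stalkChartIso : ∀ (R : Type) [CommRing R] (r : ℕ) (x : Fin r → R)
    (y : ↥(affineBlowup (Ideal.span (Set.range x)))),
    ∃ (i : Fin r) (q : PrimeSpectrum (HomogeneousLocalization.Away (reesGrading (Ideal.span (Set.range x)))
        (reesT (x i) (Ideal.subset_span (Set.mem_range_self i))))),
      x i ≠ 0 ∧ Nonempty (((affineBlowup (Ideal.span (Set.range x))).presheaf.stalk y) ≃+*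
        Localization.AtPrime q.asIdeal) := by
  intro R _ r x y
  obtain ⟨i, hxi, hi⟩ := exists_mem_basicOpen_reesT x y
  rw [← Proj.opensRange_awayι (reesGrading (Ideal.span (Set.range x)))
    (reesT (x i) (Ideal.subset_span (Set.mem_range_self i)))
    (reesT_mem (x i) (Ideal.subset_span (Set.mem_range_self i))) Nat.one_pos] at hi
  obtain ⟨q, rfl⟩ := Scheme.Hom.mem_opensRange.mp hi
  exact ⟨i, q, hxi, ⟨((asIso ((Proj.awayι (reesGrading (Ideal.span (Set.range x)))
    (reesT (x i) (Ideal.subset_span (Set.mem_range_self i)))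
    (reesT_mem (x i) (Ideal.subset_span (Set.mem_range_self i))) Nat.one_pos).stalkMap q)
      ).commRingCatIsoToRingEquiv).trans (Spec.stalkIso (.of _) q).commRingCatIsoToRingEquiv⟩⟩

end Summit.ResolutionOfSingularities.ResolutionOfSingularities.Theorems.FInjectiveMacaulayfication.StalkChartIso
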